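import Summits.CriticalPhenomena.PercolationContinuityZ3.Theorems.Transplant.FKConnectivityAllQHubCovEquiv
import Summits.CriticalPhenomena.PercolationContinuityZ3.Theorems.Transplant.FKConnectivityAllQPendantTools
import HarnessLib

/-!
# Connectivity correlation inequalities for `φ_{w,q}`, every `q > 0` — the hub covariance bound, file 5: PINNING THE HUB PAIRS and
# the EQUIVALENCE of the two conjecture nodes `HubCovBoundFKLtOne ⟺ EdgeNegCorrAdjFKLtOne`

Support file (`--supports stmt-CriticalPhenomena-4575`), FK sub-lane `prim-bschramm-fk-3` (gen 7) of the post-continuity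
programme; builds on p205010 (kernel theorem, internal audit signed; external expert review pending).  No definitions, no named
facts, no sorries; standard axioms.

THE IDENTITY (new).  For the hub pair `e = xy` with parameter `p = w(e)`, the three-point expression satisfies EXACTLY
`TP_w(x; y, z) = (1 − p)·TP_{w[e ↦ 0]}(x; y, z)`
(`threePoint_update_hub_pair`): in the one-pair affine expansion `TP_w = (1−p)²TP⁰ + p²TP¹ + 2p(1−p)B(M⁰,M¹)` the contracted corner has
`TP¹ = 0` (with `xy` surely open no pattern separates `x` from `y`) and the polarised term is `2B(M⁰, M¹) = TP⁰` (toggle identity at `e`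
for the `e`-insensitive event "`z` is joined to `x` or to `y` off `e`").  Consequences: the hub covariance bound for `φ_w` is EQUIVALENT
to the bound for the state with both hub pairs pinned to `0` (`hubCovBoundUnder_iff_pinned`, `w(xy), w(xz) < 1`; the pinned bound
always implies the unpinned one), hence — with file 2 — **`HubCovBoundFK q ↔ EdgeNegCorrAdjFK q` for every `0 < q < 1`**
(`hubCovBoundFK_iff_edgeNegCorrAdjFK`) and `HubCovBoundFKLtOne ↔ EdgeNegCorrAdjFKLtOne`: the two conjecture nodes are one.
[cite: Grimmett2006, Thm. (3.1)(a) (p. 37); §1.4 eq. (1.20) (p. 15); §3.9 eq. (3.94) (p. 63)] [cite: Wagner2006, Conj. 5.3 (p. 13)]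
-/

noncomputable section

namespace Summit.CriticalPhenomena.PercolationContinuityZ3.Theorems

namespace FK

open MeasureTheory Set Literature.Probability.LatticeModels Literature.Probability.Percolation
open Literature.Probability.Percolation.DecisionTree (ind ind_of_mem ind_of_not_mem ind_nonneg)
open scoped Classical symmDiff

variable {V : Type*} [Fintype V]

/-! ### Symmetry in the pair -/

omit [Fintype V] in
/-- `{x ≁ y, y ↔ z} = {x ≁ z, z ↔ y}`. [folklore] -/
theorem compl_openConn_inter_openConn_swap (x y z : V) :
    ((openConn x y : Set (BondConfig V))ᶜ ∩ openConn y z) = ((openConn x z : Set (BondConfig V))ᶜ ∩ openConn z y) := by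
  ext ω
  simp only [Set.mem_inter_iff, Set.mem_compl_iff, mem_openConn_iff']
  constructor
  · rintro ⟨h1, h2⟩; exact ⟨fun h => h1 (h.trans h2.symm), h2.symm⟩
  · rintro ⟨h1, h2⟩; exact ⟨fun h => h1 (h.trans h2.symm), h2.symm⟩

omit [Fintype V] in
/-- `{x ≁ y, y ↔ z} = {x ≁ z, y ↔ z}`. [folklore] -/
theorem compl_openConn_inter_openConn_swap' (x y z : V) :
    ((openConn x y : Set (BondConfig V))ᶜ ∩ openConn y z) = ((openConn x z : Set (BondConfig V))ᶜ ∩ openConn y z) := by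
  ext ω
  simp only [Set.mem_inter_iff, Set.mem_compl_iff, mem_openConn_iff']
  constructor
  · rintro ⟨h1, h2⟩; exact ⟨fun h => h1 (h.trans h2.symm), h2⟩
  · rintro ⟨h1, h2⟩; exact ⟨fun h => h1 (h.trans h2), h2⟩

omit [Fintype V] in
/-- The hub covariance bound is symmetric in the pair `y, z`. [folklore] -/
theorem hubCovBoundUnder_comm (μ : Measure (BondConfig V)) (q : ℝ) (x y z : V) :
    HubCovBoundUnder μ q x y z ↔ HubCovBoundUnder μ q x z y := by
  unfold HubCovBoundUnder
  rw [compl_openConn_inter_openConn_swap x y z, Set.inter_comm (openConn x y) (openConn x z),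
    mul_comm (μ.real (openConn x y)) (μ.real (openConn x z))]

/-! ### Masses with the hub pair `xy` surely open -/

/-- Under `w[xy ↦ 1]` every event inside `{x ≁ y}` is null. [cite: Grimmett2006, §1.4 eq. (1.20) (p. 15)] -/
theorem sum_update_one_compl_openConn_inter (w : Sym2 V → unitInterval) (q : ℝ) (x y : V) (E : Set (BondConfig V)) :
    ∑ ω : BondConfig V, rcWeightW (Function.update w s(x, y) 1) q ∅ ω * ind ((openConn x y : Set (BondConfig V))ᶜ ∩ E) ω = 0 := by
  refine sum_rcWeightW_ind_eq_zero_ae _ q fun ω hω hE => hE.1 ?_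
  have he : s(x, y) ∈ ω := mem_of_rcWeightW_ne_zero _ q (by simp) hω
  by_cases hxy : x = y
  · subst hxy; exact SimpleGraph.Reachable.refl _
  · exact SimpleGraph.Adj.reachable ((openGraph_adj ω x y).2 ⟨he, hxy⟩)

/-- **The pinning identity.**  For the hub pair `e = xy` with `p = w(e)` and the pattern masses in the `A`-form of
`hubCovBoundUnder_iff_threePoint`: `TP_w(x; y, z) = (1 − p)·TP_{w[e↦0]}(x; y, z)` (`x ≠ y`, `q ≠ 0`).
[cite: Grimmett2006, Thm. (3.1)(a) (p. 37); §1.4 eq. (1.20) (p. 15)] -/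
theorem threePoint_update_hub_pair (w : Sym2 V → unitInterval) {q : ℝ} (hq : q ≠ 0) (x y z : V) (hxy : x ≠ y) :
    (∑ ω : BondConfig V, rcWeightW w q ∅ ω * ind ((openConn x y : Set (BondConfig V))ᶜ ∩ openConn y z) ω) *
          (rcPartitionFunctionW w q ∅ - (1 - q) * ∑ ω : BondConfig V, rcWeightW w q ∅ ω * ind (openConn x y ∩ openConn x z) ω) -
        (1 - q) *
          ((∑ ω : BondConfig V, rcWeightW w q ∅ ω *
              ind ((openConn x y : Set (BondConfig V))ᶜ ∩ (openConn x z : Set (BondConfig V))ᶜ ∩ (openConn y z : Set (BondConfig V))ᶜ) ω) *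
            (∑ ω : BondConfig V, rcWeightW w q ∅ ω * ind (openConn x y ∩ openConn x z) ω) -
           (∑ ω : BondConfig V, rcWeightW w q ∅ ω * ind (openConn x y ∩ (openConn x z : Set (BondConfig V))ᶜ) ω) *
            (∑ ω : BondConfig V, rcWeightW w q ∅ ω * ind ((openConn x y : Set (BondConfig V))ᶜ ∩ openConn x z) ω)) =
      (1 - (w s(x, y) : ℝ)) *
        ((∑ ω : BondConfig V, rcWeightW (Function.update w s(x, y) 0) q ∅ ω * ind ((openConn x y : Set (BondConfig V))ᶜ ∩ openConn y z) ω) *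
            (rcPartitionFunctionW (Function.update w s(x, y) 0) q ∅ -
              (1 - q) * ∑ ω : BondConfig V, rcWeightW (Function.update w s(x, y) 0) q ∅ ω * ind (openConn x y ∩ openConn x z) ω) -
          (1 - q) *
            ((∑ ω : BondConfig V, rcWeightW (Function.update w s(x, y) 0) q ∅ ω *
                ind ((openConn x y : Set (BondConfig V))ᶜ ∩ (openConn x z : Set (BondConfig V))ᶜ ∩ (openConn y z : Set (BondConfig V))ᶜ) ω) *
              (∑ ω : BondConfig V, rcWeightW (Function.update w s(x, y) 0) q ∅ ω * ind (openConn x y ∩ openConn x z) ω) -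
             (∑ ω : BondConfig V, rcWeightW (Function.update w s(x, y) 0) q ∅ ω * ind (openConn x y ∩ (openConn x z : Set (BondConfig V))ᶜ) ω) *
              (∑ ω : BondConfig V, rcWeightW (Function.update w s(x, y) 0) q ∅ ω * ind ((openConn x y : Set (BondConfig V))ᶜ ∩ openConn x z) ω))) := by
  -- names
  set w0 : Sym2 V → unitInterval := Function.update w s(x, y) 0 with hw0
  set w1 : Sym2 V → unitInterval := Function.update w s(x, y) 1 with hw1
  set p : ℝ := (w s(x, y) : ℝ) with hp
  set Exy : Set (BondConfig V) := openConn x y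
  set Exz : Set (BondConfig V) := openConn x z
  set Eyz : Set (BondConfig V) := openConn y z
  set A0 := ∑ ω : BondConfig V, rcWeightW w0 q ∅ ω * ind (Exyᶜ ∩ Exzᶜ ∩ Eyzᶜ) ω with hA0
  set Bxy0 := ∑ ω : BondConfig V, rcWeightW w0 q ∅ ω * ind (Exy ∩ Exzᶜ) ω with hBxy0
  set Bxz0 := ∑ ω : BondConfig V, rcWeightW w0 q ∅ ω * ind (Exyᶜ ∩ Exz) ω with hBxz0
  set Byz0 := ∑ ω : BondConfig V, rcWeightW w0 q ∅ ω * ind (Exyᶜ ∩ Eyz) ω with hByz0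
  set C0 := ∑ ω : BondConfig V, rcWeightW w0 q ∅ ω * ind (Exy ∩ Exz) ω with hC0
  set Z0 := rcPartitionFunctionW w0 q ∅ with hZ0
  -- the affine decomposition of the six masses of `w`
  rw [sum_rcWeightW_ind_affine w q s(x, y) (Exyᶜ ∩ Eyz), sum_rcWeightW_ind_affine w q s(x, y) (Exy ∩ Exz),
    sum_rcWeightW_ind_affine w q s(x, y) (Exyᶜ ∩ Exzᶜ ∩ Eyzᶜ), sum_rcWeightW_ind_affine w q s(x, y) (Exy ∩ Exzᶜ),
    sum_rcWeightW_ind_affine w q s(x, y) (Exyᶜ ∩ Exz), rcPartitionFunctionW_affine w q s(x, y)]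
  -- the masses of `w1`: the separated patterns vanish
  have hByz1 : ∑ ω : BondConfig V, rcWeightW w1 q ∅ ω * ind (Exyᶜ ∩ Eyz) ω = 0 :=
    sum_update_one_compl_openConn_inter w q x y Eyz
  have hBxz1 : ∑ ω : BondConfig V, rcWeightW w1 q ∅ ω * ind (Exyᶜ ∩ Exz) ω = 0 :=
    sum_update_one_compl_openConn_inter w q x y Exz
  have hA1 : ∑ ω : BondConfig V, rcWeightW w1 q ∅ ω * ind (Exyᶜ ∩ Exzᶜ ∩ Eyzᶜ) ω = 0 := by
    rw [Set.inter_assoc]; exact sum_update_one_compl_openConn_inter w q x y _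
  -- the `e`-insensitive event: `z` joined to `x` or to `y` off `e`
  set F : Set (BondConfig V) := {ω | (openGraph (ω \ {s(x, y)})).Reachable x z ∨ (openGraph (ω \ {s(x, y)})).Reachable y z}
    with hF
  have hFins : ∀ ω : BondConfig V, ω ∆ {s(x, y)} ∈ F ↔ ω ∈ F := by
    intro ω; simp only [hF, Set.mem_setOf_eq, symmDiff_singleton_diff_self]
  have hFcins : ∀ ω : BondConfig V, ω ∆ {s(x, y)} ∈ Fᶜ ↔ ω ∈ Fᶜ := fun ω => by
    rw [Set.mem_compl_iff, Set.mem_compl_iff, hFins]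
  -- under `w1`: `C¹ = S¹(F)`, `Bxy¹ = S¹(Fᶜ)`
  have hC1 : ∑ ω : BondConfig V, rcWeightW w1 q ∅ ω * ind (Exy ∩ Exz) ω = ∑ ω : BondConfig V, rcWeightW w1 q ∅ ω * ind F ω := by
    refine sum_rcWeightW_ind_congr_ae _ q fun ω hω => ?_
    have he : s(x, y) ∈ ω := mem_of_rcWeightW_ne_zero _ q (by simp [hw1]) hω
    have hxy' : (openGraph ω).Reachable x y :=
      SimpleGraph.Adj.reachable ((openGraph_adj ω x y).2 ⟨he, hxy⟩)
    rw [Set.mem_inter_iff, mem_openConn_iff', mem_openConn_iff', reachable_iff_off_pair (y := z) (z := y) he, hF,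
      Set.mem_setOf_eq]
    exact ⟨fun h => h.2, fun h => ⟨hxy', h⟩⟩
  have hBxy1 : ∑ ω : BondConfig V, rcWeightW w1 q ∅ ω * ind (Exy ∩ Exzᶜ) ω = ∑ ω : BondConfig V, rcWeightW w1 q ∅ ω * ind Fᶜ ω := by
    refine sum_rcWeightW_ind_congr_ae _ q fun ω hω => ?_
    have he : s(x, y) ∈ ω := mem_of_rcWeightW_ne_zero _ q (by simp [hw1]) hω
    have hxy' : (openGraph ω).Reachable x y :=
      SimpleGraph.Adj.reachable ((openGraph_adj ω x y).2 ⟨he, hxy⟩)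
    rw [Set.mem_inter_iff, Set.mem_compl_iff, mem_openConn_iff', mem_openConn_iff', reachable_iff_off_pair (y := z) (z := y) he,
      hF, Set.mem_compl_iff, Set.mem_setOf_eq]
    exact ⟨fun h => h.2, fun h => ⟨hxy', h⟩⟩
  -- toggle identities: masses of `F`, `Fᶜ` and `Z` under `w1` in terms of `w0`
  have tF := sum_rcWeightW_update_one_eq_toggle w hq x y F hFins
  have tFc := sum_rcWeightW_update_one_eq_toggle w hq x y Fᶜ hFcins
  have tZ := rcPartitionFunctionW_update_one_eq_toggle w hq x y
  rw [← hw0, ← hw1] at tF tFc tZ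
  -- under `w0` (`e` surely closed): `F ⟺ z ~ x ∨ z ~ y`
  have hdel : ∀ ω : BondConfig V, rcWeightW w0 q ∅ ω ≠ 0 → ω \ {s(x, y)} = ω := fun ω hω =>
    Set.sdiff_singleton_eq_self (not_mem_of_rcWeightW_ne_zero _ q (by simp [hw0]) hω)
  have hF0 : ∑ ω : BondConfig V, rcWeightW w0 q ∅ ω * ind F ω = C0 + Bxz0 + Byz0 := by
    have h1 : ∑ ω : BondConfig V, rcWeightW w0 q ∅ ω * ind F ω = ∑ ω : BondConfig V, rcWeightW w0 q ∅ ω * ind (Exz ∪ Eyz) ω := by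
      refine sum_rcWeightW_ind_congr_ae _ q fun ω hω => ?_
      rw [hF, Set.mem_setOf_eq, hdel ω hω, Set.mem_union, mem_openConn_iff', mem_openConn_iff']
    rw [h1]
    have h2 : ∑ ω : BondConfig V, rcWeightW w0 q ∅ ω * ind (Exz ∪ Eyz) ω =
        ∑ ω : BondConfig V, rcWeightW w0 q ∅ ω * ind Exz ω + ∑ ω : BondConfig V, rcWeightW w0 q ∅ ω * ind (Exzᶜ ∩ Eyz) ω := by
      rw [sum_rcWeightW_ind_split w0 q (Exz ∪ Eyz) Exz]
      congr 1
      · refine sum_rcWeightW_ind_congr_set w0 q (Set.ext fun ω => ?_)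
        simp only [Set.mem_inter_iff, Set.mem_union]; tauto
      · refine sum_rcWeightW_ind_congr_set w0 q (Set.ext fun ω => ?_)
        simp only [Set.mem_inter_iff, Set.mem_union, Set.mem_compl_iff]; tauto
    rw [h2, mass_openConn_split w0 q x z y, Set.inter_comm Exz Exy, Set.inter_comm Exz Exyᶜ, ← hC0, ← hBxz0,
      ← compl_openConn_inter_openConn_swap' x y z, ← hByz0]
  have hFxy0 : ∑ ω : BondConfig V, rcWeightW w0 q ∅ ω * ind (F ∩ Exyᶜ) ω = Bxz0 + Byz0 := by
    have h1 : ∑ ω : BondConfig V, rcWeightW w0 q ∅ ω * ind (F ∩ Exyᶜ) ω =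
        ∑ ω : BondConfig V, rcWeightW w0 q ∅ ω * ind ((Exz ∪ Eyz) ∩ Exyᶜ) ω := by
      refine sum_rcWeightW_ind_congr_ae _ q fun ω hω => ?_
      rw [Set.mem_inter_iff, Set.mem_inter_iff, hF, Set.mem_setOf_eq, hdel ω hω, Set.mem_union, mem_openConn_iff',
        mem_openConn_iff']
    rw [h1, sum_rcWeightW_ind_split w0 q ((Exz ∪ Eyz) ∩ Exyᶜ) Exz, hBxz0, hByz0]
    congr 1
    · refine sum_rcWeightW_ind_congr_set w0 q (Set.ext fun ω => ?_)
      simp only [Set.mem_inter_iff, Set.mem_union, Set.mem_compl_iff]; tauto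
    · refine sum_rcWeightW_ind_congr_set w0 q (Set.ext fun ω => ?_)
      simp only [Set.mem_inter_iff, Set.mem_union, Set.mem_compl_iff]
      constructor
      · rintro ⟨⟨h1 | h1, h2⟩, h3⟩
        · exact absurd h1 h3
        · exact ⟨h2, h1⟩
      · rintro ⟨h2, h1⟩
        exact ⟨⟨Or.inr h1, h2⟩, fun h => h2 (h.trans h1.symm)⟩
  have hFc0 : ∑ ω : BondConfig V, rcWeightW w0 q ∅ ω * ind Fᶜ ω = A0 + Bxy0 := by
    have h1 := sum_rcWeightW_ind_compl w0 q F
    rw [hF0] at h1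
    have h2 : Z0 = C0 + Bxy0 + Bxz0 + Byz0 + A0 := partition_eq_pattern_masses w0 q x y z
    rw [← hZ0] at h1; linarith
  have hFcxy0 : ∑ ω : BondConfig V, rcWeightW w0 q ∅ ω * ind (Fᶜ ∩ Exyᶜ) ω = A0 := by
    have h1 := sum_rcWeightW_ind_split w0 q Exyᶜ F
    rw [Set.inter_comm Exyᶜ F, hFxy0, Set.inter_comm Exyᶜ Fᶜ] at h1
    have h2 : ∑ ω : BondConfig V, rcWeightW w0 q ∅ ω * ind Exyᶜ ω = Bxz0 + (Byz0 + A0) := by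
      rw [sum_rcWeightW_ind_split w0 q Exyᶜ Exz, hBxz0, mass_sees_neither_split w0 q x y z, hByz0, hA0]
    linarith
  have hSxy0 : ∑ ω : BondConfig V, rcWeightW w0 q ∅ ω * ind Exyᶜ ω = Bxz0 + (Byz0 + A0) := by
    rw [sum_rcWeightW_ind_split w0 q Exyᶜ Exz, hBxz0, mass_sees_neither_split w0 q x y z, hByz0, hA0]
  -- substitute everything
  rw [hByz1, hBxz1, hA1, hC1, hBxy1, tF, tFc, tZ, hF0, hFxy0, hFc0, hFcxy0, hSxy0]
  field_simp
  ring

/-! ### Pinning the hub pairs -/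

/-- **The bound is insensitive to the hub pair `xy` (if `w(xy) < 1`).** [cite: Grimmett2006, §3.9 eq. (3.94) (p. 63)] -/
theorem hubCovBoundUnder_iff_update_xy_zero {q : ℝ} (hq0 : 0 < q) (w : Sym2 V → unitInterval) (x y z : V) (hxy : x ≠ y)
    (h1 : (w s(x, y) : ℝ) < 1) :
    HubCovBoundUnder (rcMeasureW w q ∅) q x y z ↔ HubCovBoundUnder (rcMeasureW (Function.update w s(x, y) 0) q ∅) q x y z := by
  rw [hubCovBoundUnder_iff_threePoint hq0, hubCovBoundUnder_iff_threePoint hq0, threePoint_update_hub_pair w hq0.ne' x y z hxy]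
  have hp : 0 < 1 - (w s(x, y) : ℝ) := by linarith
  constructor
  · intro h
    by_contra hc
    push Not at hc
    have := mul_neg_of_pos_of_neg hp hc
    linarith
  · intro h
    exact mul_nonneg hp.le h

/-- The bound for the state with `xy` pinned to `0` implies the bound for `w` (any parameter on `xy`).
[cite: Grimmett2006, §3.9 eq. (3.94) (p. 63)] -/
theorem hubCovBoundUnder_of_update_xy_zero {q : ℝ} (hq0 : 0 < q) (w : Sym2 V → unitInterval) (x y z : V)
    (h : HubCovBoundUnder (rcMeasureW (Function.update w s(x, y) 0) q ∅) q x y z) :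
    HubCovBoundUnder (rcMeasureW w q ∅) q x y z := by
  haveI := isProbabilityMeasure_rcMeasureW w hq0 (∅ : Set V)
  by_cases hxy : x = y
  · subst hxy; exact hubCovBoundUnder_of_eq_left _ q x z
  rw [hubCovBoundUnder_iff_threePoint hq0, threePoint_update_hub_pair w hq0.ne' x y z hxy]
  rw [hubCovBoundUnder_iff_threePoint hq0] at h
  exact mul_nonneg (by linarith [(w s(x, y)).2.2]) h

/-- **The bound for the doubly pinned state `w[xy ↦ 0][xz ↦ 0]` implies the bound for `w`.**
[cite: Grimmett2006, §3.9 eq. (3.94) (p. 63)] -/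
theorem hubCovBoundUnder_of_pinned {q : ℝ} (hq0 : 0 < q) (w : Sym2 V → unitInterval) (x y z : V)
    (h : HubCovBoundUnder (rcMeasureW (Function.update (Function.update w s(x, y) 0) s(x, z) 0) q ∅) q x y z) :
    HubCovBoundUnder (rcMeasureW w q ∅) q x y z := by
  refine hubCovBoundUnder_of_update_xy_zero hq0 w x y z ?_
  rw [hubCovBoundUnder_comm]
  refine hubCovBoundUnder_of_update_xy_zero hq0 (Function.update w s(x, y) 0) x z y ?_
  rw [hubCovBoundUnder_comm]
  exact h

/-- **For `w(xy), w(xz) < 1` the bound for `w` is EQUIVALENT to the bound for the doubly pinned state.**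
[cite: Grimmett2006, §3.9 eq. (3.94) (p. 63)] -/
theorem hubCovBoundUnder_iff_pinned {q : ℝ} (hq0 : 0 < q) (w : Sym2 V → unitInterval) (x y z : V) (hxy : x ≠ y) (hxz : x ≠ z)
    (h1 : (w s(x, y) : ℝ) < 1) (h2 : (w s(x, z) : ℝ) < 1) :
    HubCovBoundUnder (rcMeasureW w q ∅) q x y z ↔
      HubCovBoundUnder (rcMeasureW (Function.update (Function.update w s(x, y) 0) s(x, z) 0) q ∅) q x y z := by
  refine ⟨fun h => ?_, hubCovBoundUnder_of_pinned hq0 w x y z⟩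
  have h' := (hubCovBoundUnder_iff_update_xy_zero hq0 w x y z hxy h1).1 h
  rw [hubCovBoundUnder_comm] at h' ⊢
  by_cases hyz : y = z
  · subst hyz
    rw [hubCovBoundUnder_comm]
    haveI := isProbabilityMeasure_rcMeasureW (Function.update (Function.update w s(x, y) 0) s(x, y) 0) hq0 (∅ : Set V)
    exact hubCovBoundUnder_of_eq _ hq0.le x y
  have hfe : s(x, z) ≠ s(x, y) := by
    intro hh; rw [Sym2.eq_iff] at hh
    rcases hh with ⟨-, hh⟩ | ⟨hh1, hh2⟩
    · exact hyz hh.symm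
    · exact hyz (hh2.trans hh1).symm
  have h2' : ((Function.update w s(x, y) 0 s(x, z) : unitInterval) : ℝ) < 1 := by
    rw [Function.update_of_ne hfe]; exact h2
  exact (hubCovBoundUnder_iff_update_xy_zero hq0 (Function.update w s(x, y) 0) x z y hxz h2').1 h'

/-! ### The two conjecture nodes are one -/

/-- **`EdgeNegCorrAdjOn V q ⇒` the hub covariance bound for EVERY weight vector on `V`** (`0 < q < 1`).
[cite: Grimmett2006, §3.9 eq. (3.94) (p. 63)] [cite: Wagner2006, Conj. 5.3 (p. 13)] -/
theorem hubCovBoundUnder_of_edgeNegCorrAdjOn' {q : ℝ} (hq0 : 0 < q) (hq1 : q < 1) (hNC : EdgeNegCorrAdjOn V q)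
    (w : Sym2 V → unitInterval) (x y z : V) : HubCovBoundUnder (rcMeasureW w q ∅) q x y z := by
  refine hubCovBoundUnder_of_pinned hq0 w x y z (hubCovBoundUnder_of_edgeNegCorrAdjOn hq0 hq1 hNC _ x y z ?_ (by simp))
  by_cases hyz : y = z
  · subst hyz; simp
  · have hfe : s(x, y) ≠ s(x, z) := by
      intro hh; rw [Sym2.eq_iff] at hh
      rcases hh with ⟨-, hh⟩ | ⟨hh1, hh2⟩
      · exact hyz hh
      · exact hyz (hh2.trans hh1)
    rw [Function.update_of_ne hfe]; simp

/-- **`HubCovBoundFK q ↔ EdgeNegCorrAdjFK q` for every `0 < q < 1`**: the hub covariance bound on every finite weighted graph IS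
negative correlation of adjacent edges on every finite weighted graph. [cite: Grimmett2006, §3.9 eq. (3.94) (p. 63)]
[cite: Wagner2006, Conj. 5.3 (p. 13)] -/
theorem hubCovBoundFK_iff_edgeNegCorrAdjFK {q : ℝ} (hq0 : 0 < q) (hq1 : q < 1) : HubCovBoundFK q ↔ EdgeNegCorrAdjFK q :=
  ⟨edgeNegCorrAdjFK_of_hubCovBoundFK hq0 hq1.le,
    fun h n w x y z => hubCovBoundUnder_of_edgeNegCorrAdjOn' hq0 hq1 (h n) w x y z⟩

/-- **The conjecture nodes coincide: `HubCovBoundFKLtOne ↔ EdgeNegCorrAdjFKLtOne`.** [cite: Grimmett2006, §3.9 (p. 63)]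
[cite: Wagner2006, Conj. 5.3 (p. 13)] -/
theorem hubCovBoundFKLtOne_iff_edgeNegCorrAdjFKLtOne : HubCovBoundFKLtOne ↔ EdgeNegCorrAdjFKLtOne :=
  ⟨edgeNegCorrAdjFKLtOne_of_hubCovBoundFKLtOne,
    fun h q hq0 hq1 => (hubCovBoundFK_iff_edgeNegCorrAdjFK hq0 hq1).2 (h q hq0 hq1)⟩

/-- In particular full edge-negative association for every `q < 1` (Grimmett's open problem) gives the hub covariance bound for every
`q < 1`. [cite: Grimmett2006, §3.9 (p. 63)] -/
theorem hubCovBoundFKLtOne_of_edgeNegCorrFKLtOne (h : EdgeNegCorrFKLtOne) : HubCovBoundFKLtOne :=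
  hubCovBoundFKLtOne_iff_edgeNegCorrAdjFKLtOne.2 (edgeNegCorrAdjFKLtOne_of_edgeNegCorrFKLtOne h)

end FK

end Summit.CriticalPhenomena.PercolationContinuityZ3.Theorems

end
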